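import Summits.BirchSwinnertonDyer.Rank1Residual.Additive.X4TamDefectLevelLoweringFromPrintMinus
import Literature.NumberTheory.EllipticCurves.ModularJacobianModPMultiplicityOne
import HarnessLib

/-!
# TAM-DEFECT₂ on the twist-good locus, ODD twists, from the PRINTED multiplicity-one theorem + the MINUS Eichler–Shimura dictionary node (cell `b2b-bsdres`, seat additive-p4, line V42/V43 re-key, minus twin)

HONEST FRAMING (verbatim, cell `b2b-bsdres`): the goal of the cell is to DELETE the COMBINATION-SHAPED
residual classes for ALL analytic-rank `≤ 1` curves over `ℚ` — "full BSD formula for every rank `≤ 1`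
curve in class `C`" assembled STRICTLY from published theorems — so that the rank-`≤ 1` remainder
becomes exactly the CONSTRUCTION-SHAPED classes, which are TYPED (missing-input Props), NOT attempted;
this is not "finishing BSD". This file: the MINUS twin of `X4TamDefectLevelLoweringFromWiles` — ONE typed
target (`@[conjecture] def`, asserting nothing), the mod-`p` Eichler–Shimura dictionary from the printed
`J₀(N)[𝔪]`-statement to the seat's MINUS predicate `ModPMultiplicityOneMinus` (gen 23 K5), and the
RE-KEYED END of gen 23's `X4.bsdp_of_multiplicityOneMinus_quadraticTwist_of_neg_of_five_le` (K6; odd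
twists `d < 0` — 10 of the 39 twist-good TAM₂ cells at `p ≥ 5`, 381 of 463 at `p = 3`) whose (MO⁻)
binder is DISCHARGED from the landed named fact
`Literature.NumberTheory.EllipticCurves.ModularForms.wiles1995_multiplicityOne` (cc-typer-1, p317688;
DDT Thm. 4.26 AS PRINTED) + the dictionary node + the fact's Galois package. Duty of record: cc-lead
GEN 41 ADDENDUM 2 (A2) / GEN 45. Nothing booked; X4 CONSTRUCTION-SHAPED; no Literature fact minted.

## The minus dictionary node

`LevelLowering.EichlerShimuraModPMultiplicityOneMinus N p χ θ`: as the plus node, with the conclusion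
(MO⁻) `ModPMultiplicityOneMinus k N θ` — the `θ`-eigen MINUS subspace (`Φ|ι = −Φ`) of
`Symb_{Γ₀(N)}(Sym⁰ k)` has dimension `≤ 1`. CONTENT: the same dictionary (`J₀(N)[p] ≅ H₁(X₀(N),ℤ) ⊗ 𝔽_p`,
duality, boundary symbols Eisenstein, `±`-splitting for odd `p`: `dim_{𝕋/𝔪} J₀(N)[𝔪] = 2` gives ONE
line for EACH sign), same rider `ES-dict-p3-elliptic`. A TARGET; nothing asserted.

## References

* H. Darmon, F. Diamond, R. Taylor, *Fermat's Last Theorem* (1995), Thm. 4.26 (§4.5 p. 134), §1.3, §4.1. [cite: DarmonDiamondTaylor1995, Thm. 4.26 (§4.5, p. 134)]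
* A. Ash, G. Stevens, Duke Math. J. 53 (1986), §4. [cite: AshStevens1986, §4]
* Ju. I. Manin (1972), Thm. 1.9; L. Merel, LNM 1585 (1994), §1.2. [cite: Manin1972, Thm. 1.9] [cite: Merel1994, §1.2]
* C.-H. Kim, Amer. J. Math. 148 (2026) = arXiv:2203.12159, Thm. 1.9 (6), Conj. 1.10. [cite: Kim2022StructureSelmer, Thm. 1.9 (6) and Conj. 1.10 (PDF p. 8)]
-/

noncomputable section

open scoped MatrixGroups ModularForm NumberTheorySymbols NumberField

open CongruenceSubgroup Finset IsDedekindDomain Polynomial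

open Literature.NumberTheory.EllipticCurves Literature.NumberTheory.EllipticCurves.ModularForms

namespace Summit.BirchSwinnertonDyer.Rank1Residual.LevelLowering

/-! ### §1 The Eichler–Shimura mod-`p` dictionary node, minus part -/

section Dictionary

variable {k : Type*} [CommRing k] (N : ℕ) [NeZero N] (p : ℕ) (χ : HeckeRing0 N 2 →+* k) (θ : ℕ → k)

/-- **EICHLER–SHIMURA mod-`p` DICTIONARY, MINUS PART (typed target).** For `χ : 𝕋_ℤ(N) → k` with
`χ(T_q) = θ(q)` at every prime `q`, `p ∈ ker χ` and `ker χ` maximal: the printed multiplicity-one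
CONCLUSION `dim_{𝕋/ker χ} J₀(N)[ker χ] = 2` (DDT Thm. 4.26 over `J0 N`) implies (MO⁻)
`ModPMultiplicityOneMinus k N θ` (the `θ`-eigen MINUS subspace of `Symb_{Γ₀(N)}(Sym⁰ k)` has dimension
`≤ 1`), granted the rider `ES-dict-p3-elliptic` (`p ≠ 3 ∨ 9 ∣ N ∨` some prime `q ∣ N` with
`q ≡ 2 (mod 3)`). Standard, NOT typed in the tree: A TARGET; nothing asserted. SUPERSEDED
(print-police finding F1, n1011-lit 2026-08-22: the dictionary needs `ker χ` NON-Eisenstein, not bound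
here): use `EichlerShimuraModPMultiplicityOneMinusOfIrreducible` (file
`X4TamDefectLevelLoweringFromWilesIrreducible`), which adds the irreducibility package and is implied by
this node.
[cite: DarmonDiamondTaylor1995, Thm. 4.26 (§4.5, p. 134)] [cite: AshStevens1986, §4] [cite: Manin1972, Thm. 1.9] -/
@[conjecture] def EichlerShimuraModPMultiplicityOneMinus : Prop :=
  (∀ (q : ℕ) (hq : q.Prime), χ (HeckeRing0.T N 2 q hq) = θ q) →
    (p : HeckeRing0 N 2) ∈ RingHom.ker χ → (RingHom.ker χ).IsMaximal →
    Module.finrank (HeckeRing0 N 2 ⧸ RingHom.ker χ)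
        (Submodule.torsionBySet (HeckeRing0 N 2) (J0 N) (RingHom.ker χ : Set (HeckeRing0 N 2))) = 2 →
    (p ≠ 3 ∨ 9 ∣ N ∨ ∃ q : ℕ, q.Prime ∧ q ∣ N ∧ q % 3 = 2) →
    ModPMultiplicityOneMinus k N θ

variable {N p χ θ}

/-- If (MO⁻) holds outright, the minus dictionary target holds. [folklore] -/
theorem eichlerShimuraModPMultiplicityOneMinus_of_modPMultiplicityOneMinus
    (h : ModPMultiplicityOneMinus k N θ) : EichlerShimuraModPMultiplicityOneMinus N p χ θ :=
  fun _ _ _ _ _ ↦ h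

end Dictionary

end Summit.BirchSwinnertonDyer.Rank1Residual.LevelLowering

/-! ### §2 The re-keyed END for odd twists: (MO⁻) from `wiles1995_multiplicityOne` + the minus dictionary -/

namespace Summit.BirchSwinnertonDyer.Rank1Residual.X4

open Complex WeierstrassCurve Literature.NumberTheory.EllipticCurves.Rank1Residual
  Literature.NumberTheory.EllipticCurves.Rank1Residual.Typed
  Summit.BirchSwinnertonDyer.Rank1Residual.Additive
  Summit.BirchSwinnertonDyer.Rank1Residual.LevelLowering
  Literature.NumberTheory.GaloisRepresentations Rat.HeightOneSpectrum

variable {k : Type*} [CommRing k] [Nontrivial k]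
  (W₀ W : WeierstrassCurve ℚ) [W₀.IsElliptic] [W₀.IsGloballyMinimal] [W.IsElliptic] [W.IsGloballyMinimal]
  (p : ℕ) [hp5 : Fact p.Prime] (ι : ZMod p →+* k)

/-- **TAM-DEFECT₂ ON THE TWIST-GOOD LOCUS, ODD TWIST `d < 0`, FROM THE PRINTED MULTIPLICITY-ONE
THEOREM.** Gen 23's `bsdp_of_multiplicityOneMinus_quadraticTwist_of_neg_of_five_le` (K6) with its (MO⁻)
binder DISCHARGED from: the named fact `wiles1995_multiplicityOne` (DDT Thm. 4.26, BY NAME), the mod-`p`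
eigencharacter `χ₀ : 𝕋_ℤ(N₀) → k` of `W₀`, `𝔪₀ = ker χ₀` maximal with `p ∈ 𝔪₀`, the printed level
condition, the fact's Galois package (`ρ : ModPGaloisRep ℚ k' 2` with the printed Frobenius
char-polys, irreducible) and the MINUS dictionary TARGET (rider moot at `p ≥ 5`). All other inputs as
in K6: Kim 2026 Thm. 1.8 (6), Cassels–Tate, GZK, modularity (PUBLISHED) + the minus-symbol integrality
numeral + (OLD⁻) at the Tamagawa prime `ℓ` + numerals ⟹ **`BSD(E,p)`**. Nothing booked.
[cite: DarmonDiamondTaylor1995, Thm. 4.26 (§4.5, p. 134)] [cite: Kim2022StructureSelmer, Thm. 1.9 (6) and Conj. 1.10 (PDF p. 8)]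
[cite: Ribet1990, Thm. 1.1 and Thm. 5.2 (b)] [cite: SilvermanAEC2009, Thm. X.4.14] -/
theorem bsdp_of_wiles1995_quadraticTwist_of_neg_of_five_le
    (hW1 : wiles1995_multiplicityOne)
    (hKimk : Kim2026.rankZero_le_padicValNat_sha_of_kuriharaNumber_ne_zero)
    (hE67c : Kim2026.rankZero_padicValNat_sha_add_le_of_forall_pow_dvd_kuriharaNumber_cyclicLevel)
    (hCT : exists_casselsTate_pairing (K := ℚ))
    (hGZK : rank_eq_analyticRank_of_analyticRank_le_one) (hmod : hasEntireLFunction_rat)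
    (hp : 5 ≤ p) (hr : W.analyticRank = 0) (hsurj : W.HasSurjectiveModNGaloisRep p)
    {N : ℕ} [NeZero N] (D : ModularParametrizationData W N) (hN : W.conductorNorm ℤ = N)
    (hc : ¬ (p : ℤ) ∣ D.maninConstant)
    (hper : ∃ u : ℚ, ‖(u : ℚ_[p])‖ = 1 ∧ W.realPeriodRat = u * plusPeriod D.f)
    {q' : ℚ} (hq' : shaAn W = (q' : ℂ)) (hv : padicValRat p q' = 0)
    (hc2 : padicValNat p W.tamagawaProduct ≤ 2)
    {d : ℤ} (hd4 : d % 4 = 1) (hsq : Squarefree d) (hd : d < 0) (C : VariableChange ℚ)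
    (hC : C • W₀.quadraticTwist (d : ℚ) = W)
    (hgm : ∀ v : HeightOneSpectrum (𝓞 ℚ), ((Rat.HeightOneSpectrum.primesEquiv v : ℕ) : ℤ) ∣ d →
      W₀.HasGoodReductionAt v ∨ W₀.HasMultiplicativeReductionAt v)
    {N₀ : ℕ} [NeZero N₀] [NeZero d.natAbs] {f₀ : CuspForm (Gamma0 N₀) 2} (hf₀ : IsNewformOf W₀ f₀)
    (hN₀ : N₀ ∣ N) (hm : d.natAbs ^ 2 ∣ N) (hmN : d.natAbs ∣ W.conductorNorm ℤ)
    (hper₀ : ∃ u : ℚ, ‖(u : ℚ_[p])‖ = 1 ∧ W₀.imaginaryPeriodRat = u * minusPeriod f₀)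
    (hint : ∀ x : ℚ, ¬ p ∣ (ratMinusSymbol f₀ x).den)
    -- (MO⁻) from print
    (χ₀ : HeckeRing0 N₀ 2 →+* k)
    (hχ₀ : ∀ (q : ℕ) (hq : q.Prime), χ₀ (HeckeRing0.T N₀ 2 q hq) = ι ((W₀.LFunction q : ℤ) : ZMod p))
    (hp𝔪 : (p : HeckeRing0 N₀ 2) ∈ RingHom.ker χ₀) (h𝔪 : (RingHom.ker χ₀).IsMaximal)
    (hpN₀ : ¬ p ∣ N₀ ∨ (¬ p ^ 2 ∣ N₀ ∧ HeckeRing0.T N₀ 2 p hp5.out ∉ RingHom.ker χ₀))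
    (k' : Type) [Field k'] [TopologicalSpace k'] [DiscreteTopology k']
    (ι' : HeckeRing0 N₀ 2 ⧸ RingHom.ker χ₀ →+* k') (ρ : ModPGaloisRep ℚ k' 2)
    (hρ : ∀ v : HeightOneSpectrum (𝓞 ℚ), ¬ ((primesEquiv v : Nat.Primes) : ℕ) ∣ N₀ * p →
        ρ.IsUnramifiedAt v ∧
          ρ.HasFrobCharpolyAt v
            (X ^ 2
              - Polynomial.C (ι' (Ideal.Quotient.mk (RingHom.ker χ₀) (HeckeRing0.T N₀ 2
                  ((primesEquiv v : Nat.Primes) : ℕ) (primesEquiv v : Nat.Primes).2))) * X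
              + Polynomial.C (((primesEquiv v : Nat.Primes) : ℕ) : k')))
    (hρirr : FramedRep.IsIrreducible ρ)
    (hES : EichlerShimuraModPMultiplicityOneMinus N₀ p χ₀ (fun q ↦ ι ((W₀.LFunction q : ℤ) : ZMod p)))
    -- (OLD⁻) at the Tamagawa prime
    {ℓ : ℕ} {w : k} {μ : ℚ → k} (hℓN : ℓ ∣ W.conductorNorm ℤ) (hℓ : ℓ.Coprime d.natAbs)
    (hOLD : HasOldEigenMinusSymb k N₀ (fun q ↦ ι ((W₀.LFunction q : ℤ) : ZMod p)) ℓ w μ)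
    (hμ : IsPeriodic μ)
    (hH : ∀ q : ℕ, Kato.IsKolyvaginPrime W p 1 q → HeckeRel μ q (ι ((W₀.LFunction q : ℤ) : ZMod p)))
    (hw : w * ι ((J((ℓ : ℤ) | d.natAbs) : ℤ) : ZMod p) = 1) : BSDp W p := by
  have hp2 : p ≠ 2 := by omega
  have hfin := (hW1 N₀ p hp2 (RingHom.ker χ₀) h𝔪 hp𝔪 k' ι' ρ hρ hρirr hpN₀).1
  have hMO : ModPMultiplicityOneMinus k N₀ (fun q ↦ ι ((W₀.LFunction q : ℤ) : ZMod p)) :=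
    hES hχ₀ hp𝔪 h𝔪 hfin (Or.inl (by omega))
  exact bsdp_of_multiplicityOneMinus_quadraticTwist_of_neg_of_five_le W p ι W₀ hKimk hE67c hCT hGZK hmod
    hp hr hsurj D hN hc hper hq' hv hc2 hd4 hsq hd C hC hgm hf₀ hN₀ hm hmN hper₀ hint hMO hℓN hℓ hOLD hμ
    hH hw

end Summit.BirchSwinnertonDyer.Rank1Residual.X4

end
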